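import Summits.QuantumFields.BalabanUV.Beta.GAN24.BorderedFrameInverseBlocks
import Summits.QuantumFields.BalabanUV.Beta.GAN24.FibreArrow

/-!
# `BalabanUV.Beta.GAN24.ArrowOperator` — binder row G-an2-4 / (CONV-C), road P1-fibre, row **P1-L10** `FibreStrip` ((I3′), the strip half of the K-slot),
# cut «(M4) scaled alias-space Neumann, two anchors» (`HOME/b2b-balaban-gan24-formalise-leaf-16/L10-CUT-M4.md`), module **F1 (currency)**:
# the ARROW OPERATOR of the U = 1 KKT Bloch fibre as ONE finite matrix (block-diagonal in the aliases, bordered by the (φ, c) columns and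
# the (Q, M) rows), its dictionary with an2's `fibreFun (blochChar p)` at EVERY COMPLEX momentum, and the Euclidean operator-norm bookkeeping
# (structured norm bound, a-priori bound ⇒ invertibility, Neumann step) on which the two anchors and the two perturbation estimates are stated.

NOT IN PRINT; OUR PROOF ATTEMPT (of the road; THIS file is [folklore] finite-dimensional linear algebra and box-Fourier bookkeeping over `ℂ`).
HONEST FRAMING (cell contract, verbatim): «discharging `BetaPertH` makes Bałaban's UV stability UNCONDITIONAL — a real constructive-QFT result;
it is NOT the continuum limit and NOT the Clay problem.»  HONEST DEPENDENCY (verbatim): «continuum YM on T⁴ ⇐ BetaPertH ∧ nine spine estimates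
(0/9 proved); BetaPertH ⇐ (D1) ∧ (D4) ∧ CAP+tail; G-an2-4 gates asym, D1 and NE2/3/4.»  No cited fact, no wall binder, no `def … : Prop` hypothesis,
no estimate; nothing of the K-slot of (CONV-C) is discharged here.  NOT summit progress.

## Why (gan24-p1's DESIGNER'S RULING on L10, journal l.3079, and the cut M4)
(I3′) = a `j`-UNIFORM strip bound for `kFibΔ_j`; by leaf-06's `StripRegularPackaging` (Y10r) it reduces to (U1) `det F_N(p) ≠ 0` and (U2) a sup bound on
`Strip (d+1) κ`, `N = Lc^(j+1)`.  In ALIAS coordinates (leaf-06's `FibreArrow.EL_iff/G_iff/M_iff/Q_iff`, valid for every complex `p`) the fibre system is the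
ARROW SYSTEM of leaf-15's `CapacitanceSolve`: per-alias KKT blocks `T(k_m)` bordered by the constraint multiplier `φ`, the gauge constant `c`, the Q rows and the
M row.  This file packages that system as ONE square matrix `arrowMat X` over the index `(Loc D × ι) ⊕ Loc D` (`Loc D = Fin D ⊕ Unit`: field slots ⊕ the gauge
slot), for ABSTRACT data `X : ArrowData D ι` (blocks `T`, border weights `wE wG wM wQ`), so that (i) SCALING by per-(alias, slot) weights is again an arrow matrix,
(ii) the difference of two arrow matrices is the arrow matrix of the difference data (`arrowMat_sub`), (iii) the Euclidean operator norm is bounded STRUCTURALLY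
by `sup_m ‖T m‖ + ‖borders‖` (companion `ArrowNorms`), (iv) an a-priori bound `‖x‖ ≤ K‖arrowMat X x‖` gives `IsUnit` and `‖(arrowMat X)⁻¹‖ ≤ K`
(companion `ArrowNorms`), (v) the Neumann step of E1 (`BorderedFrameInverse.neumann`) transports invertibility + inverse bound from an ANCHOR to a
nearby arrow matrix (companion `ArrowNorms`); and (vi) for the CONCRETE data `aliasArrow N p` of an2's fibre (symbols `dhat/dflat/lapSym ∘ kFine p`, weights
`chiHat·sflat, chiHat, boxS, boxSs`) — `fibreFun (blochChar p) v = r ↔ ∃ c, arrowMat (aliasArrow N p) *ᵥ pack … = pack (sources)` and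
**`det_trigPolySymbol_ne_zero_of_arrow_injective`**: injectivity of the arrow matrix at a COMPLEX `p` gives (U1) there.  The generic ANCHOR lemmas (bordered
inverse with invertible blocks) and all NORM statements are the companion module `ArrowNorms` (F1b); the SCALINGS of the cut (inner/outer radii, the scaled alias
data = KKT blocks of the NORMALISED symbols, `arrowMat (scaled) = D_ρ · arrowMat · D_σ`, unit KKT block) are `ArrowScaling` (F1c);
THIS file is pure algebra (defs, `mulVec` formulas, linearity in the data, the dictionary, (U1)-transfer); the analytic inputs are rows F2–F8 of the cut.
-/

noncomputable section

open Matrix WithLp Complex Finset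
open scoped Matrix.Norms.L2Operator InnerProductSpace BigOperators
open Literature.MathematicalPhysics.QuantumFieldTheory.Balaban1983to89.Beta
open Literature.Probability.LatticeModels (TorusSite)
open BlochFibreMatrix (Idx blochChar fibreFun fibreMatrix stencil pieceMatrix fibreMatrix_mulVec fibreMatrix_blochChar_eq_trigPolySymbol)
open FibreInverseDecay (trigPolySymbol)
open Summit.QuantumFields.BalabanUV.Beta.GAN24.FibreSymbols (dhat dflat lapSym)
open Summit.QuantumFields.BalabanUV.Beta.GAN24.FibreBlockSolve (dot)
open Summit.QuantumFields.BalabanUV.Beta.GAN24.FibreDFT (kFine amp synth synth_amp)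
open Summit.QuantumFields.BalabanUV.Beta.GAN24.FibreDFTDictionary (ampA ampμ)
open Summit.QuantumFields.BalabanUV.Beta.GAN24.FibreArrow (chiHat sflat boxS boxSs srcEL srcG rG EL_iff G_iff M_iff Q_iff fibreFun_eq_iff_rows)

namespace Summit.QuantumFields.BalabanUV.Beta.GAN24.ArrowOperator

/-! ## §1 The arrow operator of abstract data -/

/-- [folklore] The LOCAL SLOTS of one alias: `D` field components `Â_κ(m)` ⊕ the gauge multiplier `μ̂(m)`; the same type indexes the border
unknowns `φ_κ` ⊕ `c` and the border rows `Q_κ` ⊕ `M`, and the local rows EL`(m, κ)` ⊕ G`(m)`. -/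
abbrev Loc (D : ℕ) : Type := Fin D ⊕ Unit

/-- [folklore] The index of the arrow system: local slots of every alias ⊕ the border slots. -/
abbrev AIdx (D : ℕ) (ι : Type*) : Type _ := (Loc D × ι) ⊕ Loc D

/-- [folklore] ARROW DATA over an alias index `ι`: per-alias blocks `T m` (rows EL/G × columns A/μ) and the four border weight families of
`CapacitanceSolve.Fibre` (`wE`: coefficient of `φ_κ` in EL`(m,κ)`; `wG`: of `c` in G`(m)`; `wM`: of `μ̂(m)` in the M row; `wQ`: of `Â_κ(m)` in `Q_κ`). -/
structure ArrowData (D : ℕ) (ι : Type*) where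
  /-- per-alias KKT block -/
  T : ι → Matrix (Loc D) (Loc D) ℂ
  /-- EL-row border weight (coefficient of `φ_κ`, enters with a minus sign) -/
  wE : ι → Fin D → ℂ
  /-- G-row border weight (coefficient of `c`, enters with a minus sign) -/
  wG : ι → ℂ
  /-- M-row weight of `μ̂(m)` -/
  wM : ι → ℂ
  /-- Q-row weight of `Â_κ(m)` -/
  wQ : ι → Fin D → ℂ

namespace ArrowData

variable {D : ℕ} {ι : Type*}

/-- [folklore] The local-row border weights as one function on the slots: `inl κ ↦ wE m κ`, `inr ↦ wG m`. -/
def locW (X : ArrowData D ι) (m : ι) : Loc D → ℂ := Sum.elim (X.wE m) fun _ => X.wG m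

/-- [folklore] The border-row weights as one function on the slots: `inl κ ↦ wQ m κ`, `inr ↦ wM m`. -/
def borW (X : ArrowData D ι) (m : ι) : Loc D → ℂ := Sum.elim (X.wQ m) fun _ => X.wM m

/-- [folklore] Componentwise difference of arrow data. -/
instance instSub : Sub (ArrowData D ι) :=
  ⟨fun X Y => ⟨fun m => X.T m - Y.T m, fun m => X.wE m - Y.wE m, fun m => X.wG m - Y.wG m, fun m => X.wM m - Y.wM m,
    fun m => X.wQ m - Y.wQ m⟩⟩

/-- [folklore] Blocks of a difference. -/
@[simp] theorem sub_T (X Y : ArrowData D ι) (m : ι) : (X - Y).T m = X.T m - Y.T m := rfl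
/-- [folklore] `wE` of a difference. -/
@[simp] theorem sub_wE (X Y : ArrowData D ι) (m : ι) : (X - Y).wE m = X.wE m - Y.wE m := rfl
/-- [folklore] `wG` of a difference. -/
@[simp] theorem sub_wG (X Y : ArrowData D ι) (m : ι) : (X - Y).wG m = X.wG m - Y.wG m := rfl
/-- [folklore] `wM` of a difference. -/
@[simp] theorem sub_wM (X Y : ArrowData D ι) (m : ι) : (X - Y).wM m = X.wM m - Y.wM m := rfl
/-- [folklore] `wQ` of a difference. -/
@[simp] theorem sub_wQ (X Y : ArrowData D ι) (m : ι) : (X - Y).wQ m = X.wQ m - Y.wQ m := rfl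

/-- [folklore] `locW` of a difference. -/
theorem locW_sub (X Y : ArrowData D ι) (m : ι) : (X - Y).locW m = X.locW m - Y.locW m := by
  funext s; cases s <;> rfl

/-- [folklore] `borW` of a difference. -/
theorem borW_sub (X Y : ArrowData D ι) (m : ι) : (X - Y).borW m = X.borW m - Y.borW m := by
  funext s; cases s <;> rfl

end ArrowData

open ArrowData

variable {D : ℕ} {ι : Type*} [Fintype ι] [DecidableEq ι]

/-- [folklore] The SIGNED column-border weights `−locW` (the `φ`/`c` feeds enter the EL/G rows with a minus sign). -/
def negLocW (X : ArrowData D ι) (m : ι) (s : Loc D) : ℂ := -X.locW m s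

/-- [folklore] The COLUMN BORDER: unknown `φ_κ` feeds row EL`(m, κ)` with `−wE m κ`, unknown `c` feeds row G`(m)` with `−wG m` (slot-diagonal; this IS
`ArrowNorms.colBorder (negLocW X)` by `rfl` — the bridge is stated in `ArrowScaling`, which imports both files). -/
def borU (X : ArrowData D ι) : Matrix (Loc D × ι) (Loc D) ℂ := of fun i s => if i.1 = s then negLocW X i.2 s else 0

/-- [folklore] The ROW BORDER: row `Q_κ` reads `Â_κ(m)` with `wQ m κ`, row M reads `μ̂(m)` with `wM m` (slot-diagonal; `= ArrowNorms.rowBorder X.borW` by `rfl`). -/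
def borV (X : ArrowData D ι) : Matrix (Loc D) (Loc D × ι) ℂ := of fun s i => if s = i.1 then X.borW i.2 s else 0

/-- [folklore] **THE ARROW MATRIX** `[[blockDiagonal T, borU],[borV, 0]]`. -/
def arrowMat (X : ArrowData D ι) : Matrix (AIdx D ι) (AIdx D ι) ℂ := fromBlocks (blockDiagonal X.T) (borU X) (borV X) 0

omit [Fintype ι] [DecidableEq ι] in
/-- [folklore] The column border acts slot-diagonally: `(borU X x_b)(s, m) = −locW m s · x_b s`. -/
theorem borU_mulVec (X : ArrowData D ι) (xb : Loc D → ℂ) (s : Loc D) (m : ι) :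
    (borU X *ᵥ xb) (s, m) = -(X.locW m s * xb s) := by
  simp only [borU, negLocW, mulVec, dotProduct, of_apply, ite_mul, zero_mul, Finset.sum_ite_eq, Finset.mem_univ, if_true, neg_mul]

omit [DecidableEq ι] in
/-- [folklore] The row border sums over the aliases: `(borV X x)(s) = Σ_m borW m s · x (s, m)`. -/
theorem borV_mulVec (X : ArrowData D ι) (xl : Loc D × ι → ℂ) (s : Loc D) :
    (borV X *ᵥ xl) s = ∑ m, X.borW m s * xl (s, m) := by
  simp only [borV, mulVec, dotProduct, of_apply, ite_mul, zero_mul]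
  rw [Fintype.sum_prod_type, Finset.sum_comm]
  simp only [Finset.sum_ite_eq, Finset.mem_univ, if_true]

/-- [folklore] `blockDiagonal T` acts alias by alias. -/
theorem blockDiagonal_mulVec_apply (T : ι → Matrix (Loc D) (Loc D) ℂ) (xl : Loc D × ι → ℂ) (s : Loc D) (m : ι) :
    (blockDiagonal T *ᵥ xl) (s, m) = (T m *ᵥ fun s' => xl (s', m)) s := by
  simp only [mulVec, dotProduct, Fintype.sum_prod_type, blockDiagonal_apply', ite_mul, zero_mul, Finset.sum_ite_eq,
    Finset.mem_univ, if_true]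

/-- [folklore] LOCAL ROWS of the arrow matrix: `(arrowMat X x)(s, m) = (T m · x(·, m)) s − locW m s · x_b s`. -/
theorem arrowMat_mulVec_inl (X : ArrowData D ι) (xl : Loc D × ι → ℂ) (xb : Loc D → ℂ) (s : Loc D) (m : ι) :
    (arrowMat X *ᵥ Sum.elim xl xb) (Sum.inl (s, m)) = (X.T m *ᵥ fun s' => xl (s', m)) s - X.locW m s * xb s := by
  rw [arrowMat, fromBlocks_mulVec, Sum.elim_comp_inl, Sum.elim_comp_inr, Sum.elim_inl, Pi.add_apply, blockDiagonal_mulVec_apply,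
    borU_mulVec, sub_eq_add_neg]

/-- [folklore] BORDER ROWS of the arrow matrix: `(arrowMat X x)(s) = Σ_m borW m s · x(s, m)`. -/
theorem arrowMat_mulVec_inr (X : ArrowData D ι) (xl : Loc D × ι → ℂ) (xb : Loc D → ℂ) (s : Loc D) :
    (arrowMat X *ᵥ Sum.elim xl xb) (Sum.inr s) = ∑ m, X.borW m s * xl (s, m) := by
  rw [arrowMat, fromBlocks_mulVec, Sum.elim_comp_inl, Sum.elim_comp_inr, Sum.elim_inr, Pi.add_apply, zero_mulVec, Pi.zero_apply,
    add_zero, borV_mulVec]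

omit [Fintype ι] in
/-- [folklore] The arrow matrix is LINEAR in the data: `arrowMat X − arrowMat Y = arrowMat (X − Y)`. -/
theorem arrowMat_sub (X Y : ArrowData D ι) : arrowMat X - arrowMat Y = arrowMat (X - Y) := by
  ext i j
  rcases i with ⟨s, m⟩ | s <;> rcases j with ⟨s', m'⟩ | s'
  · simp only [arrowMat, Matrix.sub_apply, fromBlocks_apply₁₁, blockDiagonal_apply', sub_T]
    split_ifs <;> simp
  · simp only [arrowMat, Matrix.sub_apply, fromBlocks_apply₁₂, borU, negLocW, of_apply, locW_sub, Pi.sub_apply]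
    split_ifs <;> ring
  · simp only [arrowMat, Matrix.sub_apply, fromBlocks_apply₂₁, borV, of_apply, borW_sub, Pi.sub_apply]
    split_ifs <;> ring
  · simp only [arrowMat, Matrix.sub_apply, fromBlocks_apply₂₂, Matrix.zero_apply, sub_zero]

/-! ## §2 The KKT block of one alias and the packing of unknowns/sources -/

/-- [folklore] THE KKT BLOCK of symbols `(∂̂, ∂̂♭, L)`: rows EL`_κ = 2(L δ_{κl} − ∂̂_κ∂̂♭_l)·A_l − L∂̂_κ·μ`, G `= L∂̂♭_l·A_l` (S1a / `CapacitanceSolve.ELRows/GRows`). -/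
def tBlock (dd db : Fin D → ℂ) (L : ℂ) : Matrix (Loc D) (Loc D) ℂ :=
  of fun i j => match i, j with
    | Sum.inl κ, Sum.inl l => 2 * ((if κ = l then L else 0) - dd κ * db l)
    | Sum.inl κ, Sum.inr _ => -(L * dd κ)
    | Sum.inr _, Sum.inl l => L * db l
    | Sum.inr _, Sum.inr _ => 0

/-- [folklore] EL row `κ` of the KKT block applied to local data `v` (`v (inl l) = A_l`, `v (inr ()) = μ`). -/
theorem tBlock_mulVec_inl (dd db : Fin D → ℂ) (L : ℂ) (v : Loc D → ℂ) (κ : Fin D) :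
    (tBlock dd db L *ᵥ v) (Sum.inl κ) =
      2 * (L * v (Sum.inl κ) - dd κ * ∑ l, db l * v (Sum.inl l)) - L * dd κ * v (Sum.inr ()) := by
  have hδ : ∑ l, (if κ = l then L else 0) * v (Sum.inl l) = L * v (Sum.inl κ) := by
    simp only [ite_mul, zero_mul, Finset.sum_ite_eq, Finset.mem_univ, if_true]
  have hsplit : ∑ l, 2 * ((if κ = l then L else 0) - dd κ * db l) * v (Sum.inl l) =
      2 * (∑ l, (if κ = l then L else 0) * v (Sum.inl l)) - 2 * (dd κ * ∑ l, db l * v (Sum.inl l)) := by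
    rw [Finset.mul_sum, Finset.mul_sum, Finset.mul_sum, ← Finset.sum_sub_distrib]
    exact Finset.sum_congr rfl fun l _ => by ring
  simp only [tBlock, mulVec, dotProduct, of_apply, Fintype.sum_sum_type, Finset.univ_unique, Finset.sum_singleton]
  rw [hsplit, hδ]
  ring

/-- [folklore] G row of the KKT block applied to local data `v`. -/
theorem tBlock_mulVec_inr (dd db : Fin D → ℂ) (L : ℂ) (v : Loc D → ℂ) (u : Unit) :
    (tBlock dd db L *ᵥ v) (Sum.inr u) = L * ∑ l, db l * v (Sum.inl l) := by
  simp only [tBlock, mulVec, dotProduct, of_apply, Fintype.sum_sum_type, Finset.univ_unique, Finset.sum_singleton, zero_mul,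
    add_zero, Finset.mul_sum]
  exact Finset.sum_congr rfl fun l _ => by ring

/-- [folklore] PACKING of per-alias field/multiplier data and border data into one vector on `AIdx`. -/
def pack (A : ι → Fin D → ℂ) (μ : ι → ℂ) (φ : Fin D → ℂ) (c : ℂ) : AIdx D ι → ℂ :=
  Sum.elim (fun i => Sum.elim (A i.2) (fun _ => μ i.2) i.1) (Sum.elim φ fun _ => c)

omit [Fintype ι] [DecidableEq ι] in
/-- [folklore] `pack` as a `Sum.elim`. -/
theorem pack_eq_sumElim (A : ι → Fin D → ℂ) (μ : ι → ℂ) (φ : Fin D → ℂ) (c : ℂ) :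
    pack A μ φ c = Sum.elim (fun i : Loc D × ι => Sum.elim (A i.2) (fun _ => μ i.2) i.1) (Sum.elim φ fun _ => c) := rfl

omit [Fintype ι] [DecidableEq ι] in
/-- [folklore] A packed vector vanishes iff all four components vanish. -/
theorem pack_eq_zero_iff (A : ι → Fin D → ℂ) (μ : ι → ℂ) (φ : Fin D → ℂ) (c : ℂ) :
    pack A μ φ c = 0 ↔ A = 0 ∧ μ = 0 ∧ φ = 0 ∧ c = 0 := by
  constructor
  · intro h
    have hA : A = 0 := by
      funext m κ; have := congrFun h (Sum.inl (Sum.inl κ, m)); simpa [pack] using this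
    have hμ : μ = 0 := by
      funext m; have := congrFun h (Sum.inl (Sum.inr (), m)); simpa [pack] using this
    have hφ : φ = 0 := by
      funext κ; have := congrFun h (Sum.inr (Sum.inl κ)); simpa [pack] using this
    have hc : c = 0 := by
      have := congrFun h (Sum.inr (Sum.inr ())); simpa [pack] using this
    exact ⟨hA, hμ, hφ, hc⟩
  · rintro ⟨rfl, rfl, rfl, rfl⟩
    funext i
    rcases i with ⟨s, m⟩ | s
    · cases s <;> rfl
    · cases s <;> rfl

/-- [folklore] DATA FROM SYMBOLS: arrow data whose blocks are KKT blocks `tBlock (dd m) (db m) (L m)`. -/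
def ofSymbols (dd db : ι → Fin D → ℂ) (L : ι → ℂ) (wE : ι → Fin D → ℂ) (wG wM : ι → ℂ) (wQ : ι → Fin D → ℂ) : ArrowData D ι :=
  ⟨fun m => tBlock (dd m) (db m) (L m), wE, wG, wM, wQ⟩

/-- [folklore] Row EL`(m, κ)` of the arrow system on packed data. -/
theorem arrow_pack_EL (dd db : ι → Fin D → ℂ) (L : ι → ℂ) (wE : ι → Fin D → ℂ) (wG wM : ι → ℂ) (wQ : ι → Fin D → ℂ)
    (A : ι → Fin D → ℂ) (μ : ι → ℂ) (φ : Fin D → ℂ) (c : ℂ) (m : ι) (κ : Fin D) :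
    (arrowMat (ofSymbols dd db L wE wG wM wQ) *ᵥ pack A μ φ c) (Sum.inl (Sum.inl κ, m)) =
      2 * (L m * A m κ - dd m κ * dot (db m) (A m)) - L m * dd m κ * μ m - wE m κ * φ κ := by
  rw [pack, arrowMat_mulVec_inl]
  simp only [ofSymbols, locW, Sum.elim_inl, Sum.elim_inr, tBlock_mulVec_inl, dot]

/-- [folklore] Row G`(m)` of the arrow system on packed data. -/
theorem arrow_pack_G (dd db : ι → Fin D → ℂ) (L : ι → ℂ) (wE : ι → Fin D → ℂ) (wG wM : ι → ℂ) (wQ : ι → Fin D → ℂ)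
    (A : ι → Fin D → ℂ) (μ : ι → ℂ) (φ : Fin D → ℂ) (c : ℂ) (m : ι) (u : Unit) :
    (arrowMat (ofSymbols dd db L wE wG wM wQ) *ᵥ pack A μ φ c) (Sum.inl (Sum.inr u, m)) = L m * dot (db m) (A m) - wG m * c := by
  rw [pack, arrowMat_mulVec_inl]
  simp only [ofSymbols, locW, Sum.elim_inl, Sum.elim_inr, tBlock_mulVec_inr, dot]

/-- [folklore] Row `Q_κ` of the arrow system on packed data. -/
theorem arrow_pack_Q (dd db : ι → Fin D → ℂ) (L : ι → ℂ) (wE : ι → Fin D → ℂ) (wG wM : ι → ℂ) (wQ : ι → Fin D → ℂ)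
    (A : ι → Fin D → ℂ) (μ : ι → ℂ) (φ : Fin D → ℂ) (c : ℂ) (κ : Fin D) :
    (arrowMat (ofSymbols dd db L wE wG wM wQ) *ᵥ pack A μ φ c) (Sum.inr (Sum.inl κ)) = ∑ m, wQ m κ * A m κ := by
  rw [pack, arrowMat_mulVec_inr]
  simp only [ofSymbols, borW, Sum.elim_inl]

/-- [folklore] Row M of the arrow system on packed data. -/
theorem arrow_pack_M (dd db : ι → Fin D → ℂ) (L : ι → ℂ) (wE : ι → Fin D → ℂ) (wG wM : ι → ℂ) (wQ : ι → Fin D → ℂ)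
    (A : ι → Fin D → ℂ) (μ : ι → ℂ) (φ : Fin D → ℂ) (c : ℂ) (u : Unit) :
    (arrowMat (ofSymbols dd db L wE wG wM wQ) *ᵥ pack A μ φ c) (Sum.inr (Sum.inr u)) = ∑ m, wM m * μ m := by
  rw [pack, arrowMat_mulVec_inr]
  simp only [ofSymbols, borW, Sum.elim_inr]

/-- [folklore] **THE ARROW EQUATIONS, UNPACKED**: for data from symbols, `arrowMat X (pack A μ φ c) = pack f γ q ρ` iff the four row families of S1a hold
(EL: `2(L_m A_{mκ} − ∂_{mκ}(∂♭_m·A_m)) − L_m∂_{mκ}μ_m − wE_{mκ}φ_κ = f_{mκ}`; G: `L_m(∂♭_m·A_m) − wG_m c = γ_m`; Q: `Σ_m wQ_{mκ}A_{mκ} = q_κ`; M: `Σ_m wM_m μ_m = ρ`). -/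
theorem arrowMat_ofSymbols_pack_eq_iff (dd db : ι → Fin D → ℂ) (L : ι → ℂ) (wE : ι → Fin D → ℂ) (wG wM : ι → ℂ) (wQ : ι → Fin D → ℂ)
    (A : ι → Fin D → ℂ) (μ : ι → ℂ) (φ : Fin D → ℂ) (c : ℂ) (f : ι → Fin D → ℂ) (γ : ι → ℂ) (q : Fin D → ℂ) (ρ : ℂ) :
    arrowMat (ofSymbols dd db L wE wG wM wQ) *ᵥ pack A μ φ c = pack f γ q ρ ↔
      (∀ m κ, 2 * (L m * A m κ - dd m κ * dot (db m) (A m)) - L m * dd m κ * μ m - wE m κ * φ κ = f m κ) ∧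
      (∀ m, L m * dot (db m) (A m) - wG m * c = γ m) ∧
      (∀ κ, ∑ m, wQ m κ * A m κ = q κ) ∧ (∑ m, wM m * μ m = ρ) := by
  constructor
  · intro h
    refine ⟨fun m κ => ?_, fun m => ?_, fun κ => ?_, ?_⟩
    · have e := congrFun h (Sum.inl (Sum.inl κ, m)); rwa [arrow_pack_EL] at e
    · have e := congrFun h (Sum.inl (Sum.inr (), m)); rwa [arrow_pack_G] at e
    · have e := congrFun h (Sum.inr (Sum.inl κ)); rwa [arrow_pack_Q] at e
    · have e := congrFun h (Sum.inr (Sum.inr ())); rwa [arrow_pack_M] at e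
  · rintro ⟨hEL, hG, hQ, hM⟩
    funext i
    rcases i with ⟨s, m⟩ | s
    · cases s with
      | inl κ => rw [arrow_pack_EL]; exact hEL m κ
      | inr u => rw [arrow_pack_G]; exact hG m
    · cases s with
      | inl κ => rw [arrow_pack_Q]; exact hQ κ
      | inr u => rw [arrow_pack_M]; exact hM

/-! ## §3 The concrete data of an2's fibre and the dictionary with `fibreFun (blochChar p)` at every complex momentum -/

section Alias

variable {N : ℕ} [NeZero N]

/-- [folklore] **THE ALIAS ARROW DATA** of the U = 1 KKT Bloch fibre at (complex) coarse momentum `p`: blocks `tBlock (∂̂(k_m), ∂̂♭(k_m), L(k_m))`,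
weights `wE = χ̂·s♭`, `wG = χ̂`, `wM = S`, `wQ = S·s_κ` (leaf-06's `FibreArrow` currency; no `L_m ≠ 0` is assumed — the zero alias is kept). -/
def aliasArrow (N : ℕ) [NeZero N] (p : Fin D → ℂ) : ArrowData D (TorusSite D N) :=
  ofSymbols (fun m => dhat (kFine p m)) (fun m => dflat (kFine p m)) (fun m => lapSym (kFine p m))
    (fun m κ => chiHat p m * sflat p m κ) (fun m => chiHat p m) (fun m => boxS p m) (fun m κ => boxSs p m κ)

/-- [folklore] The blocks of the alias data. -/
@[simp] theorem aliasArrow_T (p : Fin D → ℂ) (m : TorusSite D N) :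
    (aliasArrow N p).T m = tBlock (dhat (kFine p m)) (dflat (kFine p m)) (lapSym (kFine p m)) := rfl
/-- [folklore] `wE = χ̂·s♭`. -/
@[simp] theorem aliasArrow_wE (p : Fin D → ℂ) (m : TorusSite D N) (κ : Fin D) : (aliasArrow N p).wE m κ = chiHat p m * sflat p m κ := rfl
/-- [folklore] `wG = χ̂`. -/
@[simp] theorem aliasArrow_wG (p : Fin D → ℂ) (m : TorusSite D N) : (aliasArrow N p).wG m = chiHat p m := rfl
/-- [folklore] `wM = S`. -/
@[simp] theorem aliasArrow_wM (p : Fin D → ℂ) (m : TorusSite D N) : (aliasArrow N p).wM m = boxS p m := rfl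
/-- [folklore] `wQ = S·s_κ`. -/
@[simp] theorem aliasArrow_wQ (p : Fin D → ℂ) (m : TorusSite D N) (κ : Fin D) : (aliasArrow N p).wQ m κ = boxSs p m κ := rfl

/-- [folklore] The border source data of a box right-hand side `r`: `(q_κ, ρ) = (r (Q_κ), r (M))`. -/
def packSrc (p : Fin D → ℂ) (r : Idx D N → ℂ) : AIdx D (TorusSite D N) → ℂ :=
  pack (srcEL p r) (srcG p r) (fun κ => r (Sum.inr (Sum.inr κ))) (r (Sum.inr (Sum.inl 0)))

/-- [folklore] **THE DICTIONARY AT EVERY COMPLEX MOMENTUM**: `fibreFun (blochChar p) v = r` iff, for some gauge constant `c`, the packed amplitudes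
`(ampA p v, ampμ p v, v_φ, c)` solve the arrow system with sources `packSrc p r` (leaf-06's `EL_iff/G_iff/M_iff/Q_iff` + `fibreFun_eq_iff_rows`). -/
theorem fibreFun_eq_iff_arrowMat (p : Fin D → ℂ) (v r : Idx D N → ℂ) :
    fibreFun (⇑(blochChar p)) v = r ↔
      ∃ c : ℂ, arrowMat (aliasArrow N p) *ᵥ pack (ampA p v) (ampμ p v) (fun κ => v (Sum.inr (Sum.inr κ))) c = packSrc p r := by
  rw [fibreFun_eq_iff_rows]
  simp only [packSrc, aliasArrow, arrowMat_ofSymbols_pack_eq_iff]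
  rw [forall_congr' fun κ => EL_iff p v r κ, G_iff p v r, M_iff p v r, forall_congr' fun κ => Q_iff p v r κ]
  constructor
  · rintro ⟨hEL, ⟨c, hG⟩, hM, hQ⟩
    exact ⟨c, fun m κ => hEL κ m, hG, hQ, hM⟩
  · rintro ⟨c, hEL, hG, hQ, hM⟩
    exact ⟨fun κ m => hEL m κ, ⟨c, hG⟩, hM, hQ⟩

omit [NeZero N] in
/-- [folklore] The padded G right-hand side of the zero vector is zero. -/
theorem rG_zero : rG (0 : Idx D N → ℂ) = 0 := by
  funext z; simp [rG]

/-- [folklore] The box DFT of the zero function is zero. -/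
theorem amp_zero_fun (p : Fin D → ℂ) : amp p (0 : TorusSite D N → ℂ) = 0 := by
  funext m; simp [amp]

/-- [folklore] The packed sources of the zero right-hand side vanish. -/
theorem packSrc_zero (p : Fin D → ℂ) : packSrc p (0 : Idx D N → ℂ) = 0 := by
  rw [packSrc, pack_eq_zero_iff]
  refine ⟨?_, ?_, ?_, rfl⟩
  · funext m κ; simp [srcEL, amp]
  · funext m; rw [srcG, rG_zero, amp_zero_fun]
  · rfl

/-- [folklore] Box data is recovered from its amplitudes (`FibreDFT.synth_amp`): if `ampA p v = 0`, `ampμ p v = 0` and `v_φ = 0` then `v = 0`. -/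
theorem eq_zero_of_amp_eq_zero (p : Fin D → ℂ) {v : Idx D N → ℂ} (hA : ampA p v = 0) (hμ : ampμ p v = 0)
    (hφ : (fun κ => v (Sum.inr (Sum.inr κ))) = 0) : v = 0 := by
  funext i
  rcases i with ⟨κ, z⟩ | z | κ
  · have h1 : synth p (amp p fun z => v (Sum.inl (κ, z))) z = 0 := by
      have : (amp p fun z => v (Sum.inl (κ, z))) = 0 := by funext m; exact congrFun (congrFun hA m) κ
      rw [this]; simp [synth]
    rwa [synth_amp] at h1
  · have h1 : synth p (amp p fun z => v (Sum.inr (Sum.inl z))) z = 0 := by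
      have : (amp p fun z => v (Sum.inr (Sum.inl z))) = 0 := by funext m; exact congrFun hμ m
      rw [this]; simp [synth]
    rwa [synth_amp] at h1
  · exact congrFun hφ κ

/-- [folklore] **INJECTIVITY TRANSFER**: if the arrow matrix at `p` has trivial kernel then `fibreFun (blochChar p)` is injective. -/
theorem fibreFun_injective_of_arrow (p : Fin D → ℂ) (h : ∀ x, arrowMat (aliasArrow N p) *ᵥ x = 0 → x = 0) :
    Function.Injective (fibreFun (N := N) (⇑(blochChar p))) := by
  intro v w hvw
  have h0 : fibreFun (⇑(blochChar p)) (v - w) = 0 := by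
    rw [← BlochFibreMatrix.fibreLin_apply, map_sub, BlochFibreMatrix.fibreLin_apply, BlochFibreMatrix.fibreLin_apply, hvw, sub_self]
  obtain ⟨c, hc⟩ := (fibreFun_eq_iff_arrowMat p (v - w) 0).1 h0
  rw [packSrc_zero] at hc
  obtain ⟨hA, hμ, hφ, -⟩ := (pack_eq_zero_iff _ _ _ _).1 (h _ hc)
  exact sub_eq_zero.1 (eq_zero_of_amp_eq_zero p hA hμ hφ)

/-- [folklore] **(U1) FROM THE ARROW MATRIX**: at a COMPLEX momentum `p`, if `arrowMat (aliasArrow N p)` has trivial kernel then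
`det (trigPolySymbol (stencil (d+1)) pieceMatrix p) ≠ 0` (an2's `fibreMatrix (blochChar p)` = the trigonometric symbol; injective ⇒ unit ⇒ det ≠ 0). -/
theorem det_trigPolySymbol_ne_zero_of_arrow {d : ℕ} {N : ℕ} [NeZero N] (p : Fin (d + 1) → ℂ)
    (h : ∀ x, arrowMat (aliasArrow N p) *ᵥ x = 0 → x = 0) :
    (trigPolySymbol (stencil (d + 1)) (pieceMatrix (N := N)) p).det ≠ 0 := by
  rw [← fibreMatrix_blochChar_eq_trigPolySymbol]
  have hinj : Function.Injective (fibreMatrix (N := N) (⇑(blochChar p))).mulVec := by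
    intro v w hvw
    rw [fibreMatrix_mulVec, fibreMatrix_mulVec] at hvw
    exact fibreFun_injective_of_arrow p h hvw
  have hU : IsUnit (fibreMatrix (N := N) (⇑(blochChar p))) := Matrix.mulVec_injective_iff_isUnit.1 hinj
  exact isUnit_iff_ne_zero.1 ((isUnit_iff_isUnit_det _).1 hU)

/-- [folklore] The same from `IsUnit` of the arrow matrix. -/
theorem det_trigPolySymbol_ne_zero_of_isUnit {d : ℕ} {N : ℕ} [NeZero N] (p : Fin (d + 1) → ℂ)
    (h : IsUnit (arrowMat (aliasArrow N p))) :
    (trigPolySymbol (stencil (d + 1)) (pieceMatrix (N := N)) p).det ≠ 0 :=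
  det_trigPolySymbol_ne_zero_of_arrow p fun x hx =>
    Matrix.mulVec_injective_iff_isUnit.2 h (by rw [hx, mulVec_zero])

end Alias

end Summit.QuantumFields.BalabanUV.Beta.GAN24.ArrowOperator

end
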